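import Summits.ResolutionOfSingularities.ResolutionOfSingularities.Theorems.HomologicalConductorNoZenoSplitCountBaseChange
import HarnessLib

/-!
# Crux `NoZenoR` (stmt-ResolutionOfSingularities-19943), slot `stub_L1wCoreF`, seam3 — BC-2 WITHOUT FINITENESS OF THE BASE CHANGE
# (`N^s` under a quasi-finite base change `Spec R_B → Spec R` with `𝔪 ↦ 𝔪` and finite separable residue extension)

Route `ResolutionOfSingularities/HomologicalConductor`, crux chain W4.4.  OURS (cell res-hironaka; planner res-L0-w44-plan-1 RULING (ρ53f)
«(BC-2-fl) → o5»: res-L0-w44-stub-2's BC-2 `splitExcCount_pullback_snd` (p546424) uses `[IsFinite g]` only through the HEIGHT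
bookkeeping of BC-2a and the finiteness of the fibres of `pullback.fst`; the chart-germ map `D′ → D′_f` of `exists_chartGermData` is local,
flat, unramified with finite separable residue extension but NOT finite); AI-written, weaker than expert review; nothing of the manuscript
under review (Hironaka 2017) is used and no Theses declaration is asserted.  Def-free, `--supports 19943 --as helper`.

The finiteness of `g` is replaced by: `[LocallyQuasiFinite g] [QuasiCompact g]` (finite fibres of `pullback.fst`, Mathlib
`Scheme.Hom.finite_preimage_singleton`) and the HEIGHT CLAUSE on the closed fibre, kept BY SIGNATURE,

  `hht : ∀ ζ, (pullback.snd π g).base ζ = closedPoint R_B → Order.height ((pullback.fst π g).base ζ) = Order.height ζ`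

(true here because over the closed point `pullback.fst` is the base change of the FINITE `Spec κ(𝔪_B) → Spec κ(𝔪)`; in the consumer's
setting also because both floors are resolutions of two-dimensional germs, whose closed-fibre points have height `0` or `1`).  NOTE: the
inequality `height (fst ζ) ≤ height ζ` does NOT follow from flatness/generalizing alone (open immersions are flat and quasi-finite).

* `mem_excCurvePoints_iff_of_sq_of_height`, `excCurvePoints_eq_preimage_of_sq_of_height` — BC-2a with the height clause by signature
  (res-D-pv-045's `…ExcCurvesBaseChange` proofs, `height_apply_eq` swapped for the clause);
* **`splitExcCount_pullback_snd_of_height`** — `splitExcCount (pullback.snd π g) = splitExcCount π` for `g` locally quasi-finite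
  quasi-compact with `g⁻¹{𝔪} = {𝔪_B}`, `κ(𝔪_B)/κ(𝔪)` finite separable, honest weights, and the height clause (p546424's proof verbatim);
  `excCurvePoints_finite_and_splitExcCount_pullback_snd_of_height`.

References: J. Lipman, Publ. Math. IHÉS 36 (1969), Lemma (16.1) (p. 231) [`Lipman1969`] (context).
-/

noncomputable section

-- single-problem summit: the doubled namespace component `ResolutionOfSingularities` is forced
set_option linter.dupNamespace false

namespace Summit.ResolutionOfSingularities.ResolutionOfSingularities.Theorems.NoZeno.ExcCount

open CategoryTheory CategoryTheory.Limits AlgebraicGeometry IsLocalRing Topology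
open Literature.AlgebraicGeometry.Resolution

/-! ## BC-2a with the height clause by signature -/

section Square

variable {R RB : Type} [CommRing R] [IsLocalRing R] [CommRing RB] [IsLocalRing RB]
  {X XB : Scheme.{0}} (π : X ⟶ Spec (.of R)) (πB : XB ⟶ Spec (.of RB)) (σ : XB ⟶ X)
  (g : Spec (.of RB) ⟶ Spec (.of R)) (hsq : σ ≫ π = πB ≫ g)
  (hg : g.base ⁻¹' {closedPoint R} = {closedPoint RB})
  (hht : ∀ ζ : XB, πB.base ζ = closedPoint RB → Order.height (σ.base ζ) = Order.height ζ)

include hsq hg hht in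
/-- **`ζ` is an integral exceptional curve of `π_B` iff `σ ζ` is one of `π`** — in a commuting square `σ ≫ π = π_B ≫ g` with
`g⁻¹{𝔪} = {𝔪_B}`, GIVEN that `σ` preserves heights on the closed fibre (`hht`). [this work] -/
theorem mem_excCurvePoints_iff_of_sq_of_height (ζ : XB) :
    ζ ∈ excCurvePoints πB ↔ σ.base ζ ∈ excCurvePoints π := by
  have hbase := base_eq_closedPoint_iff_of_sq π πB σ g hsq hg ζ
  simp only [excCurvePoints, Set.mem_setOf_eq]
  constructor
  · rintro ⟨h0, h1⟩
    exact ⟨hbase.mp h0, (hht ζ h0).trans h1⟩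
  · rintro ⟨h0, h1⟩
    have h0' := hbase.mpr h0
    exact ⟨h0', (hht ζ h0').symm.trans h1⟩

include hsq hg hht in
/-- **`excCurvePoints π_B = σ⁻¹' (excCurvePoints π)`** under the height clause. [this work] -/
theorem excCurvePoints_eq_preimage_of_sq_of_height :
    excCurvePoints πB = σ.base ⁻¹' excCurvePoints π := by
  ext ζ
  exact mem_excCurvePoints_iff_of_sq_of_height π πB σ g hsq hg hht ζ

include hsq hg hht in
/-- Finitely many exceptional curves downstairs ⇒ finitely many upstairs, for `σ` quasi-compact with finite fibres
(`Scheme.Hom.finite_preimage`). [this work] -/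
theorem excCurvePoints_finite_of_sq_of_height [LocallyQuasiFinite σ] [QuasiCompact σ]
    (hfin : (excCurvePoints π).Finite) : (excCurvePoints πB).Finite := by
  rw [excCurvePoints_eq_preimage_of_sq_of_height π πB σ g hsq hg hht]
  exact σ.finite_preimage hfin

end Square

/-! ## BC-2 for a quasi-finite (not necessarily finite) base change -/

section Count

variable {R RB : Type} [CommRing R] [IsLocalRing R] [CommRing RB] [IsLocalRing RB]
  {X : Scheme.{0}} (π : X ⟶ Spec (.of R)) (g : Spec (.of RB) ⟶ Spec (.of R))
  (hg : g.base ⁻¹' {closedPoint R} = {closedPoint RB})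
  (hht : ∀ ζ : ↑(pullback π g), (pullback.snd π g).base ζ = closedPoint RB →
    Order.height ((pullback.fst π g).base ζ) = Order.height ζ)

include hg hht in
/-- BC-2a for `X ×_R R_B`: `excCurvePoints (pullback.snd π g) = fst⁻¹' (excCurvePoints π)` under the height clause. [this work] -/
theorem excCurvePoints_pullback_snd_of_height :
    excCurvePoints (pullback.snd π g) = (pullback.fst π g).base ⁻¹' excCurvePoints π :=
  excCurvePoints_eq_preimage_of_sq_of_height π (pullback.snd π g) (pullback.fst π g) g pullback.condition hg hht

include hg hht in
/-- **BC-2 for a locally quasi-finite, quasi-compact base change** `g : Spec R_B → Spec R` with `g⁻¹{𝔪} = {𝔪_B}`, `κ(𝔪_B)/κ(𝔪)` finite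
separable, `π` with finitely many integral exceptional curves of finite (honest) split weight, and the height clause on the closed
fibre: **`splitExcCount (pullback.snd π g) = splitExcCount π`** (res-L0-w44-stub-2's p546424 proof verbatim: the fibres of `pullback.fst` are
finite, `Scheme.Hom.finite_preimage_singleton`, and the weights over each `η` add up, `finsum_splitWeight_preimage_fst`). [this work] -/
theorem splitExcCount_pullback_snd_of_height [LocallyQuasiFinite g] [QuasiCompact g]
    (hfin : letI := (g.residueFieldMap (closedPoint RB)).hom.toAlgebra
      Module.Finite ((Spec (.of R)).residueField (g.base (closedPoint RB)))
        ((Spec (.of RB)).residueField (closedPoint RB)))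
    (hsep : letI := (g.residueFieldMap (closedPoint RB)).hom.toAlgebra
      Algebra.IsSeparable ((Spec (.of R)).residueField (g.base (closedPoint RB)))
        ((Spec (.of RB)).residueField (closedPoint RB)))
    (hfinπ : (excCurvePoints π).Finite)
    (hFW : ∀ η ∈ excCurvePoints π, letI := (π.residueFieldMap η).hom.toAlgebra
      FiniteDimensional ((Spec (.of R)).residueField (π.base η))
        (separableClosure ((Spec (.of R)).residueField (π.base η)) (X.residueField η))) :
    splitExcCount (pullback.snd π g) = splitExcCount π := by
  haveI : LocallyQuasiFinite (pullback.fst π g) := MorphismProperty.pullback_fst _ _ inferInstance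
  haveI : QuasiCompact (pullback.fst π g) := MorphismProperty.pullback_fst _ _ inferInstance
  unfold splitExcCount
  rw [excCurvePoints_pullback_snd_of_height π g hg hht, ← Set.biUnion_preimage_singleton]
  rw [finsum_mem_biUnion ?_ hfinπ fun η _ => (pullback.fst π g).finite_preimage_singleton η]
  · refine finsum_mem_congr rfl fun η hη => ?_
    exact finsum_splitWeight_preimage_fst π g hg η hη.1 hfin hsep (hFW η hη)
  · intro η _ η' _ hne
    refine Set.disjoint_left.mpr fun ζ h1 h2 => hne ?_
    exact h1.symm.trans h2

include hg hht in
/-- Same, packaged with the finiteness of the exceptional curves upstairs. [this work] -/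
theorem excCurvePoints_finite_and_splitExcCount_pullback_snd_of_height [LocallyQuasiFinite g] [QuasiCompact g]
    (hfin : letI := (g.residueFieldMap (closedPoint RB)).hom.toAlgebra
      Module.Finite ((Spec (.of R)).residueField (g.base (closedPoint RB)))
        ((Spec (.of RB)).residueField (closedPoint RB)))
    (hsep : letI := (g.residueFieldMap (closedPoint RB)).hom.toAlgebra
      Algebra.IsSeparable ((Spec (.of R)).residueField (g.base (closedPoint RB)))
        ((Spec (.of RB)).residueField (closedPoint RB)))
    (hfinπ : (excCurvePoints π).Finite)
    (hFW : ∀ η ∈ excCurvePoints π, letI := (π.residueFieldMap η).hom.toAlgebra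
      FiniteDimensional ((Spec (.of R)).residueField (π.base η))
        (separableClosure ((Spec (.of R)).residueField (π.base η)) (X.residueField η))) :
    (excCurvePoints (pullback.snd π g)).Finite ∧ splitExcCount (pullback.snd π g) = splitExcCount π := by
  haveI : LocallyQuasiFinite (pullback.fst π g) := MorphismProperty.pullback_fst _ _ inferInstance
  haveI : QuasiCompact (pullback.fst π g) := MorphismProperty.pullback_fst _ _ inferInstance
  exact ⟨excCurvePoints_finite_of_sq_of_height π (pullback.snd π g) (pullback.fst π g) g pullback.condition hg hht hfinπ,
    splitExcCount_pullback_snd_of_height π g hg hht hfin hsep hfinπ hFW⟩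

end Count

end Summit.ResolutionOfSingularities.ResolutionOfSingularities.Theorems.NoZeno.ExcCount

end
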